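import Summits.CriticalPhenomena.SAWScalingLimit.Theorems.SAWDefectDecoherenceBoundaryClosureRIdentificationGateHopf
import Literature.Analysis.Complex.SchwarzReflection
import Mathlib.Analysis.SpecialFunctions.Pow.Deriv
import Mathlib.Analysis.SpecialFunctions.Pow.Continuity
import Mathlib.Analysis.Calculus.DSlope
import HarnessLib

/-!
# `BoundaryClosureR` (stmt-CriticalPhenomena-14004), line `polygon-parity-squeeze`, stub
# `cornerStructure` (sub-goal (A2-corner) of `stub_polygonIdentification`)

The local Schwarz–Christoffel structure of an `ℍ`-valued holomorphic map at a straight corner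
(Pommerenke, *Boundary Behaviour of Conformal Maps*, Thm. 3.9, for a straight-sided corner).
Let `U` be open and, inside `B(c, r)`, equal to the open wedge at `c` of opening `θπ`
(`0 < θ < 2`) with bisector `e^{iψ}`; let `Φ` be holomorphic on `U` with values in the upper
half-plane, with a continuous extension `Φb` to the closed wedge near `c`, real on the two sides
and at `c`.  With the rotated variable `s = (z - c) e^{-iψ}` (`|arg s| < θπ/2 < π` on the wedge):
`Φ z - Φb c = u z · s^{1/θ}` and `Φ' z = u₁ z · s^{1/θ - 1}` on the wedge near `c` (principal
powers), with `u`, `u₁` continuous and zero-free on the CLOSED wedge near `c`.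

Proof.  The power chart `p w = c + e^{iψ} (-i w)^θ` maps the upper half-disc `B(0, r^{1/θ}) ∩ ℍ`
into the wedge, continuously up to the diameter, which goes to the two sides (`0 ↦ c`); it is
inverted by the root chart `q z = i s^{1/θ}`.  The pulled-back boundary function `g = Φb ∘ p` is
continuous on the closed upper half-disc, holomorphic with `Im > 0` on the open one and real on
the diameter, so its Schwarz reflection `G` is holomorphic on the whole disc, and `G'(0) ≠ 0` by
the boundary Hopf lemma `Identification.deriv_ne_zero_of_im_pos` (no injectivity is needed).
Hence `G w - G 0 = w · v w`, `v = dslope G 0`, `v 0 = G'(0) ≠ 0`; on a small disc `v` and `G'`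
are zero-free, and `u = i · v ∘ q`, `u₁ = (i/θ) e^{-iψ} · G' ∘ q` (`Φ = G ∘ q` on the wedge).
-/

noncomputable section

open scoped Topology ComplexConjugate
open Filter Set Metric Complex
open Summit.CriticalPhenomena.SAWScalingLimit.Theorems.PickHalfPlane

namespace Summit.CriticalPhenomena.SAWScalingLimit.Theorems.PolygonParitySqueeze

namespace CornerStructure

/-! ### 1. Wedges in terms of `re` and `‖·‖`; arguments of real powers -/

/-- For `x ≠ 0` and `α ∈ [0, π]`: `|arg x| < α ↔ ‖x‖ cos α < re x` (`re x = ‖x‖ cos (arg x)` and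
`cos` is strictly decreasing on `[0, π]`). [folklore] -/
theorem abs_arg_lt_iff {x : ℂ} (hx : x ≠ 0) {α : ℝ} (h0 : 0 ≤ α) (hπ : α ≤ Real.pi) :
    |arg x| < α ↔ ‖x‖ * Real.cos α < x.re := by
  rw [← norm_mul_cos_arg, mul_lt_mul_iff_right₀ (norm_pos_iff.2 hx), ← Real.cos_abs (arg x)]
  exact (Real.strictAntiOn_cos.lt_iff_gt ⟨h0, hπ⟩ ⟨abs_nonneg _, abs_arg_le_pi x⟩).symm

/-- A non-zero point of the CLOSED wedge `‖x‖ cos α ≤ re x` of half-opening `α < π` lies in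
the slit plane. [folklore] -/
theorem mem_slitPlane_of_norm_mul_cos_le {x : ℂ} (hx : x ≠ 0) {α : ℝ} (h0 : 0 ≤ α)
    (hπ : α < Real.pi) (h : ‖x‖ * Real.cos α ≤ x.re) : x ∈ slitPlane := by
  rw [mem_slitPlane_iff]
  by_contra hc
  push Not at hc
  have hcos : Real.cos Real.pi < Real.cos α :=
    Real.strictAntiOn_cos ⟨h0, hπ.le⟩ ⟨Real.pi_pos.le, le_rfl⟩ hπ
  rw [Real.cos_pi] at hcos
  have hre : x.re < 0 := lt_of_le_of_ne hc.1 fun h0' => hx (Complex.ext (by simpa using h0') hc.2)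
  have hxeq : ((x.re : ℝ) : ℂ) = x := Complex.ext (by simp) (by simp [hc.2])
  have hnorm : ‖x‖ = -x.re := by
    rw [← hxeq, norm_real, Real.norm_eq_abs, ofReal_re, abs_of_neg hre]
  rw [hnorm] at h
  nlinarith

/-- `arg (x ^ θ) = θ · arg x` for real `θ`, as long as `θ · arg x ∈ (-π, π)`. [folklore] -/
theorem arg_cpow_ofReal {x : ℂ} (hx : x ≠ 0) {θ : ℝ} (h : |arg x * θ| < Real.pi) :
    arg (x ^ (θ : ℂ)) = arg x * θ := by
  have him : (log x * θ).im = arg x * θ := by rw [im_mul_ofReal, log_im]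
  have h1 : -Real.pi < (log x * θ).im := by rw [him]; exact (abs_lt.1 h).1
  have h2 : (log x * θ).im ≤ Real.pi := by rw [him]; exact (abs_lt.1 h).2.le
  rw [cpow_def_of_ne_zero hx]
  calc arg (exp (log x * θ)) = (log (exp (log x * θ))).im := by rw [log_im]
    _ = arg x * θ := by rw [log_exp h1 h2, him]

/-! ### 2. The power chart `w ↦ (-i w)^θ` and the root chart `s ↦ i s^{1/θ}` -/

/-- The power chart maps the open upper half-plane into the open symmetric wedge of opening
`θπ`: for `im w > 0`, `(-i w)^θ ≠ 0` and `|arg ((-i w)^θ)| < θπ/2` (`0 < θ < 2`). [folklore] -/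
theorem powerChart_mem_wedge {w : ℂ} (hw : 0 < w.im) {θ : ℝ} (hθ : 0 < θ) (hθ2 : θ < 2) :
    (-I * w) ^ (θ : ℂ) ≠ 0 ∧ |arg ((-I * w) ^ (θ : ℂ))| < θ * Real.pi / 2 := by
  have hre : 0 < (-I * w).re := by simpa using hw
  have hw0 : w ≠ 0 := by rintro rfl; simp at hw
  have hx : -I * w ≠ 0 := mul_ne_zero (neg_ne_zero.2 I_ne_zero) hw0
  have harg : |arg (-I * w)| < Real.pi / 2 := abs_arg_lt_pi_div_two_iff.2 (Or.inl hre)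
  have hlt : |arg (-I * w) * θ| < θ * Real.pi / 2 := by
    rw [abs_mul, abs_of_pos hθ]
    have := mul_lt_mul_of_pos_right harg hθ
    linarith
  refine ⟨fun h => hx ((cpow_eq_zero_iff _ _).1 h).1, ?_⟩
  rw [arg_cpow_ofReal hx (hlt.trans_le (by nlinarith [Real.pi_pos]))]
  exact hlt

/-- The power chart maps the punctured real axis onto the two sides of the wedge:
for `im w = 0`, `w ≠ 0`, `|arg ((-i w)^θ)| = θπ/2` (`0 < θ < 2`). [folklore] -/
theorem powerChart_axis {w : ℂ} (hw : w.im = 0) (hw0 : w ≠ 0) {θ : ℝ} (hθ : 0 < θ)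
    (hθ2 : θ < 2) : |arg ((-I * w) ^ (θ : ℂ))| = θ * Real.pi / 2 := by
  have hre : (-I * w).re = 0 := by simp [hw]
  have him : (-I * w).im = -w.re := by simp
  have hwre : w.re ≠ 0 := fun h => hw0 (Complex.ext (by simpa using h) (by simpa using hw))
  have hx : -I * w ≠ 0 := mul_ne_zero (neg_ne_zero.2 I_ne_zero) hw0
  have habs : |arg (-I * w)| = Real.pi / 2 := by
    rcases lt_or_gt_of_ne hwre with hneg | hpos
    · rw [arg_eq_pi_div_two_iff.2 ⟨hre, by rw [him]; linarith⟩, abs_of_pos (by positivity)]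
    · rw [arg_eq_neg_pi_div_two_iff.2 ⟨hre, by rw [him]; linarith⟩, abs_neg,
        abs_of_pos (by positivity)]
  have hlt : |arg (-I * w) * θ| < Real.pi := by
    rw [abs_mul, habs, abs_of_pos hθ]; nlinarith [Real.pi_pos]
  rw [arg_cpow_ofReal hx hlt, abs_mul, habs, abs_of_pos hθ]
  ring

/-- The root chart on the open wedge: for `s ≠ 0` with `|arg s| < θπ/2` (`0 < θ`), the point
`i s^{1/θ}` lies in the open upper half-plane and the power chart inverts it:
`(-i (i s^{1/θ}))^θ = s`. [folklore] -/
theorem rootChart {s : ℂ} (hs : s ≠ 0) {θ : ℝ} (hθ : 0 < θ)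
    (harg : |arg s| < θ * Real.pi / 2) :
    0 < (I * s ^ ((1 / θ : ℝ) : ℂ)).im ∧ (-I * (I * s ^ ((1 / θ : ℝ) : ℂ))) ^ (θ : ℂ) = s := by
  have him : (log s * ((1 / θ : ℝ) : ℂ)).im = arg s / θ := by
    rw [im_mul_ofReal, log_im]; ring
  have hb : |arg s / θ| < Real.pi / 2 := by
    rw [abs_div, abs_of_pos hθ, div_lt_iff₀ hθ]; linarith
  have h1 : -Real.pi < (log s * ((1 / θ : ℝ) : ℂ)).im := by
    rw [him]; linarith [(abs_lt.1 hb).1, Real.pi_pos]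
  have h2 : (log s * ((1 / θ : ℝ) : ℂ)).im ≤ Real.pi := by
    rw [him]; linarith [(abs_lt.1 hb).2, Real.pi_pos]
  constructor
  · rw [I_mul_im, cpow_def_of_ne_zero hs, exp_re, him]
    exact mul_pos (Real.exp_pos _) (Real.cos_pos_of_mem_Ioo (abs_lt.1 hb))
  · have h3 : -I * (I * s ^ ((1 / θ : ℝ) : ℂ)) = s ^ ((1 / θ : ℝ) : ℂ) := by
      rw [← mul_assoc, neg_mul, I_mul_I, neg_neg, one_mul]
    have h4 : ((1 / θ : ℝ) : ℂ) * (θ : ℂ) = 1 := by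
      rw [← ofReal_mul, one_div_mul_cancel hθ.ne', ofReal_one]
    rw [h3, ← cpow_mul _ h1 h2, h4, cpow_one]

end CornerStructure

open CornerStructure

/-! ### 3. The corner structure -/

/-- **Local Schwarz–Christoffel structure at a straight corner** (registered stub
`cornerStructure`, sub-goal (A2-corner) of `stub_polygonIdentification`, crux
stmt-CriticalPhenomena-14004, line `polygon-parity-squeeze`).  If the open set `U` is, inside
`B(c, r)`, the open wedge at `c` of opening `θπ` (`0 < θ < 2`) with bisector `e^{iψ}`, `Φ` is
holomorphic on `U` with values in the upper half-plane and `Φb` is a continuous extension of `Φ`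
to the closed wedge near `c`, real on the two sides (and at `c`), then near `c`:
`Φ z - Φb c = u z · s^{1/θ}` and `Φ' z = u₁ z · s^{1/θ-1}`, `s = (z - c) e^{-iψ}` (principal
powers), with `u`, `u₁` continuous and zero-free on the closed wedge.  (Power chart, Schwarz
reflection across the straightened sides, boundary Hopf lemma `G'(0) ≠ 0`, `dslope`; the
injectivity hypothesis is not used.) [cite: PommerenkeBBCM1992, Thm. 3.9] -/
theorem cornerStructure : ∀ (U : Set ℂ) (c : ℂ) (ψ θ r : ℝ), IsOpen U → 0 < θ → θ < 2 → 0 < r → U ∩ Metric.ball c r = {z : ℂ | z ≠ c ∧ |Complex.arg ((z - c) * Complex.exp (-(ψ : ℂ) * Complex.I))| < θ * Real.pi / 2} ∩ Metric.ball c r → ∀ (Φ Φb : ℂ → ℂ), DifferentiableOn ℂ Φ U → Set.InjOn Φ U → Set.MapsTo Φ U {w : ℂ | 0 < w.im} → ContinuousOn Φb (closure U ∩ Metric.ball c r) → Set.EqOn Φb Φ (U ∩ Metric.ball c r) → (∀ z ∈ frontier U ∩ Metric.ball c r, (Φb z).im = 0) → ∃ (r' : ℝ) (u u₁ : ℂ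 → ℂ), 0 < r' ∧ r' ≤ r ∧ ContinuousOn u (closure U ∩ Metric.ball c r') ∧ ContinuousOn u₁ (closure U ∩ Metric.ball c r') ∧ (∀ z ∈ closure U ∩ Metric.ball c r', u z ≠ 0 ∧ u₁ z ≠ 0) ∧ (∀ z ∈ U ∩ Metric.ball c r', Φ z - Φb c = u z * Complex.exp (((1 / θ : ℝ) : ℂ) * Complex.log ((z - c) * Complex.exp (-(ψ : ℂ) * Complex.I)))) ∧ (∀ z ∈ U ∩ Metric.ball c r', deriv Φ z = u₁ z * Complex.exp (((1 / θ - 1 : ℝ) : ℂ) * Complex.log ((z - c) * Complex.exp (-(ψ : ℂ) * Complex.I)))) := by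
  intro U c ψ θ r hU hθ hθ2 hr hW Φ Φb hΦd _ hΦpos hΦbc hΦb hreal
  -- the angle, the unit `e = e^{-iψ}`, the exponent `a = 1/θ`, the rotated variable `s`
  set α : ℝ := θ * Real.pi / 2 with hα
  have hα0 : 0 < α := by positivity
  have hαπ : α < Real.pi := by rw [hα]; nlinarith [Real.pi_pos]
  have hθ0 : θ ≠ 0 := hθ.ne'
  set e : ℂ := exp (-(ψ : ℂ) * I) with he
  set e' : ℂ := exp ((ψ : ℂ) * I) with he'
  have hee' : e' * e = 1 := by rw [he, he', ← exp_add, neg_mul, add_neg_cancel, exp_zero]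
  have he_norm : ‖e‖ = 1 := by rw [he, norm_exp]; simp
  have he0 : e ≠ 0 := exp_ne_zero _
  set a : ℂ := ((1 / θ : ℝ) : ℂ) with ha
  have ha_re : 0 < a.re := by rw [ha, ofReal_re]; positivity
  have ha0 : a ≠ 0 := by rw [ha]; exact ofReal_ne_zero.2 (one_div_ne_zero hθ0)
  set s : ℂ → ℂ := fun z => (z - c) * e with hs
  have hsW : ∀ z, z ∈ U ∩ ball c r ↔ (z ≠ c ∧ |arg (s z)| < α) ∧ z ∈ ball c r :=
    fun z => by rw [hW]; exact Iff.rfl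
  have hs0 : ∀ z, s z = 0 ↔ z = c := fun z => by simp [hs, he0, sub_eq_zero]
  have hsnorm : ∀ z, ‖s z‖ = ‖z - c‖ := fun z => by simp [hs, he_norm]
  have hs_cont : Continuous s := by rw [hs]; fun_prop
  -- the power chart `p` (half-plane → wedge) and the root chart `q` (wedge → half-plane)
  set p : ℂ → ℂ := fun w => c + e' * (-I * w) ^ (θ : ℂ) with hp
  set q : ℂ → ℂ := fun z => I * s z ^ a with hq
  have hsp : ∀ w, s (p w) = (-I * w) ^ (θ : ℂ) := fun w => by
    simp only [hs, hp]
    rw [add_sub_cancel_left, mul_right_comm, hee', one_mul]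
  have hpnorm : ∀ w, ‖p w - c‖ = ‖w‖ ^ θ := fun w => by
    rw [← hsnorm, hsp, norm_cpow_real, norm_mul, norm_neg, norm_I, one_mul]
  have hqnorm : ∀ z, ‖q z‖ = ‖z - c‖ ^ (1 / θ) := fun z => by
    simp only [hq]
    rw [norm_mul, norm_I, one_mul, ha, norm_cpow_real, hsnorm]
  -- the radius of the chart disc
  set R : ℝ := r ^ (1 / θ) with hR
  have hR0 : 0 < R := Real.rpow_pos_of_pos hr _
  have hball_p : ∀ w ∈ ball (0 : ℂ) R, p w ∈ ball c r := by
    intro w hw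
    rw [mem_ball, dist_eq_norm, hpnorm]; rw [mem_ball_zero_iff] at hw
    calc ‖w‖ ^ θ < R ^ θ := Real.rpow_lt_rpow (norm_nonneg _) hw hθ
      _ = r := by rw [hR, one_div, Real.rpow_inv_rpow hr.le hθ0]
  -- `p` maps the open upper half-disc into the wedge `U ∩ B(c, r)`
  have hpU : ∀ w ∈ ball (0 : ℂ) R, 0 < w.im → p w ∈ U ∩ ball c r := by
    intro w hw hwim
    obtain ⟨hne, harg⟩ := powerChart_mem_wedge hwim hθ hθ2
    refine (hsW _).2 ⟨⟨fun h => hne ?_, by rw [hsp]; exact harg⟩, hball_p w hw⟩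
    rw [← hsp, h]; exact (hs0 c).2 rfl
  -- continuity (closed half-plane) and differentiability (open half-plane) of `p`
  have hp_cont : ∀ w : ℂ, 0 ≤ w.im → ContinuousAt p w := by
    intro w hw
    have h1 : ContinuousAt (fun x : ℂ => x ^ (θ : ℂ)) (-I * w) :=
      continuousAt_cpow_const_of_re_pos (Or.inl (by simpa using hw)) (by simpa using hθ)
    have h2 : ContinuousAt (fun x : ℂ => (-I * x) ^ (θ : ℂ)) w :=
      h1.comp (continuous_const.mul continuous_id).continuousAt
    exact continuousAt_const.add (continuousAt_const.mul h2)
  have hp_diff : ∀ w : ℂ, 0 < w.im → DifferentiableAt ℂ p w := by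
    intro w hw
    have h0 : -I * w ∈ slitPlane := mem_slitPlane_iff.2 (Or.inl (by simpa using hw))
    have h1 : DifferentiableAt ℂ (fun x : ℂ => (-I * x) ^ (θ : ℂ)) w :=
      (differentiableAt_id.const_mul (-I)).cpow_const h0
    exact (h1.const_mul e').const_add c
  -- the diameter goes to the two sides: frontier points of `U`
  have hp_axis : ∀ w ∈ ball (0 : ℂ) R, w.im = 0 → p w ∈ frontier U ∩ ball c r := by
    intro w hw hwim
    refine ⟨?_, hball_p w hw⟩
    rw [hU.frontier_eq]
    refine ⟨?_, fun hpw => ?_⟩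
    · -- `w` is in the closure of the open upper half-disc, which `p` maps into `U`
      have hH : w ∈ closure (ball (0 : ℂ) R ∩ {w : ℂ | 0 < w.im}) := by
        refine isOpen_ball.inter_closure ⟨hw, ?_⟩
        rw [closure_setOf_lt_im]; simp [hwim]
      have h1 := (hp_cont w hwim.symm.le).continuousWithinAt.mem_closure_image hH
      refine closure_mono ?_ h1
      rintro _ ⟨w', ⟨hw', hw'im⟩, rfl⟩
      exact (hpU w' hw' hw'im).1
    · -- but not in `U`: `p 0 = c`, and on the punctured axis `|arg (s (p w))| = α` exactly
      obtain ⟨⟨hne, harg⟩, -⟩ := (hsW _).1 ⟨hpw, hball_p w hw⟩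
      by_cases hw0 : w = 0
      · apply hne
        simp only [hp, hw0, mul_zero, zero_cpow (ofReal_ne_zero.2 hθ0), add_zero]
      · rw [hsp, powerChart_axis hwim hw0 hθ hθ2] at harg
        exact lt_irrefl _ harg
  -- the pulled-back boundary function `g = Φb ∘ p` on the closed upper half-disc
  set g : ℂ → ℂ := fun w => Φb (p w) with hg
  have hg_cont : ContinuousOn g (ball (0 : ℂ) R ∩ {w : ℂ | 0 ≤ w.im}) := by
    refine hΦbc.comp (fun w hw => (hp_cont w hw.2).continuousWithinAt) ?_
    rintro w ⟨hw, hwim⟩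
    have hwim' : (0 : ℝ) ≤ w.im := hwim
    rcases hwim'.lt_or_eq with hlt | heq
    · exact ⟨subset_closure (hpU w hw hlt).1, hball_p w hw⟩
    · have h := hp_axis w hw heq.symm
      exact ⟨frontier_subset_closure h.1, h.2⟩
  have hg_diff : DifferentiableOn ℂ g (ball (0 : ℂ) R ∩ {w : ℂ | 0 < w.im}) := by
    rintro w ⟨hw, hwim⟩
    have hpw := hpU w hw hwim
    have h1 : DifferentiableAt ℂ Φb (p w) :=
      (hΦd.differentiableAt (hU.mem_nhds hpw.1)).congr_of_eventuallyEq
        (Filter.eventuallyEq_of_mem ((hU.inter isOpen_ball).mem_nhds hpw) hΦb)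
    exact (h1.comp w (hp_diff w hwim)).differentiableWithinAt
  have hg_real : ∀ w ∈ ball (0 : ℂ) R, w.im = 0 → (g w).im = 0 := fun w hw hwim =>
    hreal _ (hp_axis w hw hwim)
  have hg_pos : ∀ w ∈ ball (0 : ℂ) R, 0 < w.im → 0 < (g w).im := by
    intro w hw hwim
    have hpw := hpU w hw hwim
    show 0 < (Φb (p w)).im
    rw [hΦb hpw]; exact hΦpos hpw.1
  -- Schwarz reflection across the diameter
  set G : ℂ → ℂ := schwarzReflection g with hGdef
  have hG : DifferentiableOn ℂ G (ball (0 : ℂ) R) :=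
    differentiableOn_schwarzReflection isOpen_ball
      (fun w hw => by rwa [mem_ball_zero_iff, norm_conj, ← mem_ball_zero_iff]) hg_cont hg_diff
      (fun w hw hwim => conj_eq_iff_im.2 (hg_real w hw hwim))
  have hbR : ball (0 : ℂ) R ∈ 𝓝 (0 : ℂ) := isOpen_ball.mem_nhds (mem_ball_self hR0)
  have hGg : ∀ w : ℂ, 0 ≤ w.im → G w = g w := fun w hw => schwarzReflection_of_nonneg hw
  -- the boundary Hopf lemma: `G'(0) ≠ 0` (no injectivity needed)
  have hG0 : deriv G 0 ≠ 0 := by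
    refine Identification.deriv_ne_zero_of_im_pos (by simp) (hG.analyticAt hbR) ?_ ?_
    · filter_upwards [hbR] with w hw hwim
      rw [hGg w hwim.symm.le]; exact hg_real w hw hwim
    · filter_upwards [hbR] with w hw hwim
      rw [hGg w hwim.le]; exact hg_pos w hw hwim
  -- `G w - G 0 = w · v w` with `v` continuous, `v 0 = G'(0) ≠ 0`; `G'` continuous
  set v : ℂ → ℂ := dslope G 0 with hv
  have hv_cont : ContinuousOn v (ball (0 : ℂ) R) :=
    (continuousOn_dslope hbR).2 ⟨hG.continuousOn, hG.differentiableAt hbR⟩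
  have hv0 : v 0 ≠ 0 := by rwa [hv, dslope_same]
  have hGv : ∀ w, G w - G 0 = w * v w := fun w => by
    have h := sub_smul_dslope G 0 w
    rw [sub_zero, smul_eq_mul] at h; exact h.symm
  have hG'_cont : ContinuousOn (deriv G) (ball (0 : ℂ) R) :=
    (hG.analyticOnNhd isOpen_ball).deriv.continuousOn
  -- a disc `B(0, ρ) ⊆ B(0, R)` on which `v` and `G'` do not vanish
  obtain ⟨ρ, hρ0, hρ⟩ : ∃ ρ > 0, ∀ w ∈ ball (0 : ℂ) ρ,
      w ∈ ball (0 : ℂ) R ∧ v w ≠ 0 ∧ deriv G w ≠ 0 := by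
    have h1 : ∀ᶠ w in 𝓝 (0 : ℂ), v w ≠ 0 := (hv_cont.continuousAt hbR).eventually_ne hv0
    have h2 : ∀ᶠ w in 𝓝 (0 : ℂ), deriv G w ≠ 0 :=
      (hG'_cont.continuousAt hbR).eventually_ne hG0
    obtain ⟨ρ, hρ0, h⟩ :=
      Metric.eventually_nhds_iff_ball.1 ((eventually_mem_set.2 hbR).and (h1.and h2))
    exact ⟨ρ, hρ0, fun w hw => ⟨(h w hw).1, (h w hw).2.1, (h w hw).2.2⟩⟩
  -- the final radius: `q` maps `B(c, r')` into `B(0, ρ)`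
  set r' : ℝ := min r (ρ ^ θ) with hr'
  have hr'0 : 0 < r' := lt_min hr (Real.rpow_pos_of_pos hρ0 _)
  have hq_ball : ∀ z ∈ ball c r', q z ∈ ball (0 : ℂ) ρ := by
    intro z hz
    rw [mem_ball_zero_iff, hqnorm]; rw [mem_ball, dist_eq_norm] at hz
    have hz' : ‖z - c‖ < ρ ^ θ := lt_of_lt_of_le hz (min_le_right _ _)
    calc ‖z - c‖ ^ (1 / θ) < (ρ ^ θ) ^ (1 / θ) :=
        Real.rpow_lt_rpow (norm_nonneg _) hz' (by positivity)
      _ = ρ := by rw [one_div, Real.rpow_rpow_inv hρ0.le hθ0]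
  -- the closed wedge: `‖s‖ cos α ≤ re s`, so `s z ∈ slitPlane ∪ {0}` and `q` is continuous
  have hclosed : ∀ z ∈ closure U ∩ ball c r, ‖s z‖ * Real.cos α ≤ (s z).re := by
    have hC : IsClosed {z : ℂ | ‖s z‖ * Real.cos α ≤ (s z).re} :=
      isClosed_le (hs_cont.norm.mul continuous_const) (continuous_re.comp hs_cont)
    have hsub : U ∩ ball c r ⊆ {z : ℂ | ‖s z‖ * Real.cos α ≤ (s z).re} := by
      intro z hz
      obtain ⟨⟨hzc, harg⟩, -⟩ := (hsW z).1 hz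
      exact ((abs_arg_lt_iff (fun h => hzc ((hs0 z).1 h)) hα0.le hαπ.le).1 harg).le
    intro z hz
    exact closure_minimal hsub hC (isOpen_ball.closure_inter hz)
  have hq_cont : ∀ z ∈ closure U ∩ ball c r, ContinuousAt q z := by
    intro z hz
    have h0 : 0 ≤ (s z).re ∨ (s z).im ≠ 0 := by
      by_cases hzc : s z = 0
      · left; rw [hzc, zero_re]
      · have h := mem_slitPlane_of_norm_mul_cos_le hzc hα0.le hαπ (hclosed z hz)
        exact (mem_slitPlane_iff.1 h).imp_left le_of_lt
    have h1 : ContinuousAt (fun x : ℂ => x ^ a) (s z) :=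
      continuousAt_cpow_const_of_re_pos h0 ha_re
    exact continuousAt_const.mul (h1.comp hs_cont.continuousAt)
  -- on the open wedge: `q z ∈ ℍ`, `p (q z) = z`, the power as an exponential, `q'`
  have hqU : ∀ z ∈ U ∩ ball c r, 0 < (q z).im ∧ p (q z) = z ∧
      s z ^ a = exp (a * log (s z)) ∧ HasDerivAt q (I * (a * exp ((a - 1) * log (s z)) * e)) z := by
    intro z hz
    obtain ⟨⟨hzc, harg⟩, -⟩ := (hsW z).1 hz
    have hsz : s z ≠ 0 := fun h => hzc ((hs0 z).1 h)
    obtain ⟨him, hpq⟩ := rootChart hsz hθ harg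
    refine ⟨him, ?_, by rw [cpow_def_of_ne_zero hsz, mul_comm], ?_⟩
    · show c + e' * (-I * (I * s z ^ a)) ^ (θ : ℂ) = z
      rw [hpq]
      show c + e' * ((z - c) * e) = z
      rw [mul_comm (z - c) e, ← mul_assoc, hee', one_mul, add_sub_cancel]
    · have hslit : s z ∈ slitPlane := by
        refine mem_slitPlane_iff_arg.2 ⟨fun h => ?_, hsz⟩
        rw [h, abs_of_pos Real.pi_pos] at harg
        exact absurd harg (not_lt.2 hαπ.le)
      have h1 : HasDerivAt s e z := by
        have h := ((hasDerivAt_id z).sub_const c).mul_const e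
        rwa [one_mul] at h
      have h2 := h1.cpow_const (c := a) hslit
      rw [cpow_def_of_ne_zero hsz, mul_comm (log (s z))] at h2
      exact h2.const_mul I
  -- conclusion
  refine ⟨r', fun z => I * v (q z), fun z => deriv G (q z) * (I * a * e), hr'0, min_le_left _ _,
    ?_, ?_, ?_, ?_, ?_⟩
  · intro z hz
    have hz' : z ∈ closure U ∩ ball c r := ⟨hz.1, ball_subset_ball (min_le_left _ _) hz.2⟩
    have hqz := hρ _ (hq_ball z hz.2)
    exact (continuousAt_const.mul ((hv_cont.continuousAt (isOpen_ball.mem_nhds hqz.1)).comp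
      (hq_cont z hz'))).continuousWithinAt
  · intro z hz
    have hz' : z ∈ closure U ∩ ball c r := ⟨hz.1, ball_subset_ball (min_le_left _ _) hz.2⟩
    have hqz := hρ _ (hq_ball z hz.2)
    exact (((hG'_cont.continuousAt (isOpen_ball.mem_nhds hqz.1)).comp (hq_cont z hz')).mul
      continuousAt_const).continuousWithinAt
  · intro z hz
    have hqz := hρ _ (hq_ball z hz.2)
    exact ⟨mul_ne_zero I_ne_zero hqz.2.1,
      mul_ne_zero hqz.2.2 (mul_ne_zero (mul_ne_zero I_ne_zero ha0) he0)⟩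
  · -- the value formula
    intro z hz
    have hzr : z ∈ U ∩ ball c r := ⟨hz.1, ball_subset_ball (min_le_left _ _) hz.2⟩
    obtain ⟨him, hpq, hexp, -⟩ := hqU z hzr
    have h1 : Φ z = G (q z) := by
      rw [hGg _ him.le]; show Φ z = Φb (p (q z)); rw [hpq, hΦb hzr]
    have h2 : Φb c = G 0 := by
      rw [hGg 0 (by simp)]
      show Φb c = Φb (p 0)
      simp only [hp, mul_zero, zero_cpow (ofReal_ne_zero.2 hθ0), add_zero]
    rw [h1, h2, hGv]
    simp only [hq, hs] at hexp ⊢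
    rw [← hexp]; ring
  · -- the derivative formula: `Φ = G ∘ q` near `z`
    intro z hz
    have hzr : z ∈ U ∩ ball c r := ⟨hz.1, ball_subset_ball (min_le_left _ _) hz.2⟩
    obtain ⟨-, -, -, hqd⟩ := hqU z hzr
    have hqz := hρ _ (hq_ball z hz.2)
    have hev : Φ =ᶠ[𝓝 z] (G ∘ q) := by
      filter_upwards [(hU.inter isOpen_ball).mem_nhds hz] with y hy
      have hyr : y ∈ U ∩ ball c r := ⟨hy.1, ball_subset_ball (min_le_left _ _) hy.2⟩
      obtain ⟨hyim, hypq, -, -⟩ := hqU y hyr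
      show Φ y = G (q y)
      rw [hGg _ hyim.le]; show Φ y = Φb (p (q y)); rw [hypq, hΦb hyr]
    have hGd : HasDerivAt G (deriv G (q z)) (q z) :=
      (hG.differentiableAt (isOpen_ball.mem_nhds hqz.1)).hasDerivAt
    rw [hev.deriv_eq, (hGd.comp z hqd).deriv]
    have h3 : a - 1 = ((1 / θ - 1 : ℝ) : ℂ) := by rw [ha]; push_cast; ring
    rw [← h3]; simp only [hs]; ring

end Summit.CriticalPhenomena.SAWScalingLimit.Theorems.PolygonParitySqueeze

end
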